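import Summits.QuantumFields.GaugeBoot.Rows.GLYZc2D4STab
import HarnessLib

/-!
# Gauge-boot: kernel check of the raw `site1` class table of the glyz-c2-4D problems, rows 114–143 (part 6/10)

Cell `pub-gaugeboot` (HOME `run/shared/lean/pub/pub-gaugeboot/`), seat lean1 (torus layer for rows C76–C87 = the certified
glyz-c2-4D windows: label set, raw blocks, class/witness tables, the reduction identity, per-β bindings).

HONEST FRAMING (page 1 of every file of this cell): certified bounds on lattice expectations at STATED coupling,
gauge group, dimension and torus size; NOT a mass gap, NOT a continuum limit, NOT a string tension, NOT large `N`.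
The venture is explicitly NOT Yang–Mills-summit-bearing (barriers `FixedCouplingUltralocality`,
`PerturbativeInvisibility`).

`scanon_rows_<lo>_<hi> : ∀ i, lo ≤ i < hi → ∀ j ≥ i, GLYZc2D4.SCanonOK i j`, each range one closed computation (`decide +kernel`);
assembled in `GLYZc2D4Canon`.
-/

noncomputable section

open Literature.MathematicalPhysics.QuantumFieldTheory

namespace Summit.QuantumFields.GaugeBoot

namespace GLYZc2D4

set_option maxHeartbeats 0 in
/-- Rows `114 ≤ i < 120` of the `site1` class table of the glyz-c2-4D problems canonicalise (1317 entries; kernel). -/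
theorem scanon_rows_114_120 : ∀ i : Fin 336, 114 ≤ i.val → i.val < 120 → ∀ j : Fin 336, i.val ≤ j.val → GLYZc2D4.SCanonOK i j := by
  decide +kernel

set_option maxHeartbeats 0 in
/-- Rows `120 ≤ i < 126` of the `site1` class table of the glyz-c2-4D problems canonicalise (1281 entries; kernel). -/
theorem scanon_rows_120_126 : ∀ i : Fin 336, 120 ≤ i.val → i.val < 126 → ∀ j : Fin 336, i.val ≤ j.val → GLYZc2D4.SCanonOK i j := by
  decide +kernel

set_option maxHeartbeats 0 in
/-- Rows `126 ≤ i < 132` of the `site1` class table of the glyz-c2-4D problems canonicalise (1245 entries; kernel). -/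
theorem scanon_rows_126_132 : ∀ i : Fin 336, 126 ≤ i.val → i.val < 132 → ∀ j : Fin 336, i.val ≤ j.val → GLYZc2D4.SCanonOK i j := by
  decide +kernel

set_option maxHeartbeats 0 in
/-- Rows `132 ≤ i < 138` of the `site1` class table of the glyz-c2-4D problems canonicalise (1209 entries; kernel). -/
theorem scanon_rows_132_138 : ∀ i : Fin 336, 132 ≤ i.val → i.val < 138 → ∀ j : Fin 336, i.val ≤ j.val → GLYZc2D4.SCanonOK i j := by
  decide +kernel

set_option maxHeartbeats 0 in
/-- Rows `138 ≤ i < 144` of the `site1` class table of the glyz-c2-4D problems canonicalise (1173 entries; kernel). -/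
theorem scanon_rows_138_144 : ∀ i : Fin 336, 138 ≤ i.val → i.val < 144 → ∀ j : Fin 336, i.val ≤ j.val → GLYZc2D4.SCanonOK i j := by
  decide +kernel

end GLYZc2D4

end Summit.QuantumFields.GaugeBoot

end
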